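import Summits.QuantumFields.YangMills.Theorems.LuscherReductionRunningReductionCombGaugeBox
import Summits.QuantumFields.YangMills.Theorems.LuscherReductionRunningReductionWindowMass
import Summits.QuantumFields.YangMills.Theorems.LuscherReductionRunningReductionInnerCopiesForm
import HarnessLib

/-!
# β-UNIFORM floor for the top zero-flux transfer value: `λ₀(β, L) ≥ c_L · c_β^{|E|}` for all `β ≥ 1`, with `c_L > 0` INDEPENDENT of `β`
# (sub-stub C4-low₀ of the fixed-lattice programme COARSE(L₀) — route `LuscherReduction`, crux RED stmt-QuantumFields-19978 KT-door 3b′ /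
# crux `TwistedTraceScaling` stmt-QuantumFields-20203 S-BASE; design note `pub/ym-fleet/ym-luscher-20007-p1/COARSE-DESIGN.md` §8 brick (v))

DESIGN CORRECTION of `COARSE-DESIGN.md` §8: the onion / IMS error terms of the lattice semiclassics are ABSOLUTE, `ε · c_β^{|E|} · ‖ψ‖²` with
`ε ≍ β^{−1}δ^{−2}`, and must be `o(u)·λ₀‖ψ‖²`; the tree's floor `levelValue_zero_ge_poly` (`λ₀ ≥ β^{−N} c_β^{|E|}`) cannot absorb them.  This file
proves the β-UNIFORM floor (the crude `k = 0` half of the INNER Born–Oppenheimer lower bound):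
* §1 twist symmetrisation of a NONNEGATIVE function: `8⟨φ,Kφ⟩ ≤ ⟨twistSum φ, K twistSum φ⟩` (all 64 terms are `≥ 0`),
  `8‖φ‖² ≤ ‖twistSum φ‖² ≤ 64‖φ‖²` (Cauchy–Schwarz) — no disjointness of the eight copies is needed for a floor;
* §2 the potential `Φ_ρ(U) = ∫ K_β(U,V) combTrial ρ V dV` of the comb-gauge box trial function (`…CombGaugeBox`): measurable, `0 ≤ Φ ≤ e^{2β|E|}`,
  GAUGE INVARIANT (kernel and a-priori measure are), hence `Φ(treeFix U) = Φ(U)`; `⟨ψ₀,Kψ₀⟩ = ∫ ψ₀ Φ`;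
* §3 ★ `combPotential_ge`: at a comb-gauge configuration `W` (tree links `1`) with all links within `ρ/2` of `1`,
  `Φ_ρ(W) ≥ e^{−8βρ²|P|} · m_β(ρ/(14L))^{|E|}`: restrict the `V`-integral to the link-wise window `‖W_eV_e⁻¹ − 1‖_F ≤ ρ/(14L)`, on which
  `treeFix V` stays in the `ρ`-box (`frobNorm_treeFix_sub_one_le`), both magnetic energies are `≤ 8ρ²|P|`, and the electric factor integrates
  link by link to the window mass (`…WindowMass`);
* §4 `qform_combTrial_ge`: `⟨ψ₀, K ψ₀⟩ ≥ e^{−8βρ²|P|} m_β(ρ/14L)^{|E|} ballVol(ρ/2)^{offCount}` (`ψ₀ = combTrial ρ ≥ combTrial (ρ/2)`, `Φ` at `treeFix U`);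
* §5 ★★ `levelValue_zero_ge_uniform`: with `ρ = 1/√β`, `ψ = twistSum ψ₀` (physical by `isPhys_twistSum`), the min–max door, `m_β ≥ winConst·c_β`
  (`windowMass_ge_linkC`) and halving `ballVol ρ ≤ 5⁸ ballVol(ρ/2)`:
  `uniformFloorConst L · latCE L β ≤ levelValue su2Rep L β 0` for every `β ≥ 1`, `uniformFloorConst L = e^{−8|P|} winConst(1/14L)^{|E|}/(8·5^{8·offCount}) > 0`.
Physically `λ₀/c_β^{|E|} → G_L ∈ (0,1)` (the stiff-mode zero-point factor); the constant here is astronomically smaller but β-free, which is all the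
onion glue needs.  HONEST FRAMING: fixed-lattice bookkeeping; femto rung R2b1; not a gap, not infinite volume, not Clay.
-/

set_option autoImplicit false

noncomputable section

open MeasureTheory Filter Topology Real
open scoped Matrix ComplexConjugate BigOperators Matrix.Norms.Frobenius
open Literature.MathematicalPhysics.QuantumFieldTheory
open Literature.MathematicalPhysics.QuantumLattice

namespace Summit.QuantumFields.YangMills.Theorems.FemtoTransferGap

variable {L : ℕ} [NeZero L]

/-! ## §1 Twist symmetrisation of a nonnegative function -/

/-- **`8⟨φ, K_β φ⟩ ≤ ⟨twistSum φ, K_β twistSum φ⟩`** for `φ ≥ 0` bounded measurable (`β ≥ 0`): the eight diagonal terms are `⟨φ,K_βφ⟩` each and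
the fifty-six cross terms are nonnegative. [folklore] -/
theorem qform_twistSum_ge {β : ℝ} (hβ : 0 ≤ β) {φ : GaugeConfig 3 L SU2 → ℝ} (hmφ : Measurable φ) {C : ℝ} (hC : ∀ U, |φ U| ≤ C)
    (h0 : ∀ U, 0 ≤ φ U) : 8 * qform su2Rep β φ φ ≤ qform su2Rep β (twistSum φ) (twistSum φ) := by
  rw [qform_twistSum_eq_sum hβ hmφ hC]
  have hnn : ∀ z z' : Fin 3 → Bool, 0 ≤ ∫ p, φ (TT.twist3 z p.1) * transferKernel su2Rep β p.1 p.2 * φ (TT.twist3 z' p.2)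
      ∂(configMeasure SU2 L).prod (configMeasure SU2 L) := fun z z' =>
    integral_nonneg fun p => mul_nonneg (mul_nonneg (h0 _) (transferKernel_pos _ _ _ _).le) (h0 _)
  calc 8 * qform su2Rep β φ φ = ∑ z : Fin 3 → Bool, ∫ p, φ (TT.twist3 z p.1) * transferKernel su2Rep β p.1 p.2 * φ (TT.twist3 z p.2)
        ∂(configMeasure SU2 L).prod (configMeasure SU2 L) := by
        rw [Finset.sum_congr rfl fun z _ => cross_diag_eq_qform hβ hmφ hC z, Finset.sum_const, Finset.card_univ, TT.card_twists,
          nsmul_eq_mul]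
        norm_num
    _ ≤ ∑ z : Fin 3 → Bool, ∑ z' : Fin 3 → Bool, ∫ p, φ (TT.twist3 z p.1) * transferKernel su2Rep β p.1 p.2 * φ (TT.twist3 z' p.2)
        ∂(configMeasure SU2 L).prod (configMeasure SU2 L) :=
        Finset.sum_le_sum fun z _ => Finset.single_le_sum (fun z' _ => hnn z z') (Finset.mem_univ z)

/-- **`‖twistSum φ‖² ≤ 64‖φ‖²`** for bounded measurable `φ` (Cauchy–Schwarz over the eight twists; twist invariance of the a-priori measure).
[folklore] -/
theorem l2_twistSum_le {φ : GaugeConfig 3 L SU2 → ℝ} (hmφ : Measurable φ) {C : ℝ} (hC : ∀ U, |φ U| ≤ C) :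
    l2 (twistSum φ) (twistSum φ) ≤ 64 * l2 φ φ := by
  have hC0 : 0 ≤ C := (abs_nonneg _).trans (hC 1)
  have hpt : ∀ U : GaugeConfig 3 L SU2, twistSum φ U * twistSum φ U ≤ 8 * ∑ z : Fin 3 → Bool, φ (TT.twist3 z U) ^ 2 := fun U => by
    unfold twistSum
    rw [← sq]
    have h := sq_sum_le_card_mul_sum_sq (s := Finset.univ) (f := fun z : Fin 3 → Bool => φ (TT.twist3 z U))
    rw [Finset.card_univ, TT.card_twists] at h
    exact_mod_cast h
  have hint1 : Integrable (fun U => twistSum φ U * twistSum φ U) (configMeasure SU2 L) :=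
    integrable_of_bounded_lat ((measurable_twistSum hmφ).mul (measurable_twistSum hmφ)) (C := 8 * C * (8 * C)) fun U => by
      rw [abs_mul]; exact mul_le_mul (abs_twistSum_le hC U) (abs_twistSum_le hC U) (abs_nonneg _) (by positivity)
  have hint2 : ∀ z : Fin 3 → Bool, Integrable (fun U => φ (TT.twist3 z U) ^ 2) (configMeasure SU2 L) := fun z =>
    integrable_of_bounded_lat ((hmφ.comp (TT.measurable_twist3 z)).pow_const 2) (C := C ^ 2) fun U => by
      rw [abs_pow]; exact pow_le_pow_left₀ (abs_nonneg _) (hC _) 2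
  show ∫ U, twistSum φ U * twistSum φ U ∂configMeasure SU2 L ≤ 64 * l2 φ φ
  calc ∫ U, twistSum φ U * twistSum φ U ∂configMeasure SU2 L
      ≤ ∫ U, 8 * ∑ z : Fin 3 → Bool, φ (TT.twist3 z U) ^ 2 ∂configMeasure SU2 L :=
        integral_mono hint1 ((integrable_finsetSum _ fun z _ => hint2 z).const_mul 8) hpt
    _ = 8 * ∑ z : Fin 3 → Bool, ∫ U, φ (TT.twist3 z U) ^ 2 ∂configMeasure SU2 L := by
        rw [integral_const_mul, integral_finsetSum _ fun z _ => hint2 z]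
    _ = 64 * l2 φ φ := by
        rw [Finset.sum_congr rfl fun z _ => integral_sq_twist3 hmφ z, Finset.sum_const, Finset.card_univ, TT.card_twists, nsmul_eq_mul]
        norm_num; ring

/-- **`8‖φ‖² ≤ ‖twistSum φ‖²`** for `φ ≥ 0` bounded measurable (drop the cross terms). [folklore] -/
theorem l2_twistSum_ge {φ : GaugeConfig 3 L SU2 → ℝ} (hmφ : Measurable φ) {C : ℝ} (hC : ∀ U, |φ U| ≤ C) (h0 : ∀ U, 0 ≤ φ U) :
    8 * l2 φ φ ≤ l2 (twistSum φ) (twistSum φ) := by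
  have hC0 : 0 ≤ C := (abs_nonneg _).trans (hC 1)
  have hpt : ∀ U : GaugeConfig 3 L SU2, ∑ z : Fin 3 → Bool, φ (TT.twist3 z U) ^ 2 ≤ twistSum φ U * twistSum φ U := fun U => by
    unfold twistSum
    rw [Finset.sum_mul_sum]
    refine Finset.sum_le_sum fun z _ => ?_
    rw [sq]
    exact Finset.single_le_sum (f := fun z' : Fin 3 → Bool => φ (TT.twist3 z U) * φ (TT.twist3 z' U))
      (fun z' _ => mul_nonneg (h0 _) (h0 _)) (Finset.mem_univ z)
  have hint1 : Integrable (fun U => twistSum φ U * twistSum φ U) (configMeasure SU2 L) :=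
    integrable_of_bounded_lat ((measurable_twistSum hmφ).mul (measurable_twistSum hmφ)) (C := 8 * C * (8 * C)) fun U => by
      rw [abs_mul]; exact mul_le_mul (abs_twistSum_le hC U) (abs_twistSum_le hC U) (abs_nonneg _) (by positivity)
  have hint2 : ∀ z : Fin 3 → Bool, Integrable (fun U => φ (TT.twist3 z U) ^ 2) (configMeasure SU2 L) := fun z =>
    integrable_of_bounded_lat ((hmφ.comp (TT.measurable_twist3 z)).pow_const 2) (C := C ^ 2) fun U => by
      rw [abs_pow]; exact pow_le_pow_left₀ (abs_nonneg _) (hC _) 2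
  show 8 * l2 φ φ ≤ ∫ U, twistSum φ U * twistSum φ U ∂configMeasure SU2 L
  calc 8 * l2 φ φ = ∑ z : Fin 3 → Bool, ∫ U, φ (TT.twist3 z U) ^ 2 ∂configMeasure SU2 L := by
        rw [Finset.sum_congr rfl fun z _ => integral_sq_twist3 hmφ z, Finset.sum_const, Finset.card_univ, TT.card_twists, nsmul_eq_mul]
        norm_num
    _ = ∫ U, ∑ z : Fin 3 → Bool, φ (TT.twist3 z U) ^ 2 ∂configMeasure SU2 L := (integral_finsetSum _ fun z _ => hint2 z).symm
    _ ≤ ∫ U, twistSum φ U * twistSum φ U ∂configMeasure SU2 L := integral_mono (integrable_finsetSum _ fun z _ => hint2 z) hint1 hpt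

/-! ## §2 The potential of the comb-gauge box trial function -/

/-- **Potential** `Φ_ρ(U) = ∫ K_β(U,V) · combTrial ρ V dV` (`= (K_β ψ₀)(U)`). [folklore] -/
def combPotential (β ρ : ℝ) (U : GaugeConfig 3 L SU2) : ℝ := ∫ V, transferKernel su2Rep β U V * combTrial ρ V ∂configMeasure SU2 L

/-- The integrand of the potential is jointly measurable. [folklore] -/
theorem measurable_combPotential_integrand (β ρ : ℝ) :
    Measurable fun p : GaugeConfig 3 L SU2 × GaugeConfig 3 L SU2 => transferKernel su2Rep β p.1 p.2 * combTrial ρ p.2 :=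
  (measurable_transferKernel_lat β).mul ((measurable_combTrial ρ).comp measurable_snd)

/-- `Φ_ρ` is measurable (partial integral of a jointly measurable function). [folklore] -/
theorem measurable_combPotential (β ρ : ℝ) : Measurable (combPotential (L := L) β ρ) :=
  ((measurable_combPotential_integrand (L := L) β ρ).stronglyMeasurable.integral_prod_right' (ν := configMeasure SU2 L)).measurable

/-- For fixed `U` the integrand is measurable in `V` and bounded by `e^{2β|E|}` (`β ≥ 0`). [folklore] -/
theorem measurable_combPotential_integrand_left (β ρ : ℝ) (U : GaugeConfig 3 L SU2) :
    Measurable fun V : GaugeConfig 3 L SU2 => transferKernel su2Rep β U V * combTrial ρ V :=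
  Measurable.of_uncurry_left (f := fun (U V : GaugeConfig 3 L SU2) => transferKernel su2Rep β U V * combTrial ρ V)
    (measurable_combPotential_integrand β ρ)

/-- Pointwise bound of the integrand (`β ≥ 0`). [folklore] -/
theorem abs_combPotential_integrand_le {β : ℝ} (hβ : 0 ≤ β) (ρ : ℝ) (U V : GaugeConfig 3 L SU2) :
    |transferKernel su2Rep β U V * combTrial ρ V| ≤ Real.exp (2 * β) ^ Fintype.card (Edge 3 L) := by
  rw [abs_mul]
  calc |transferKernel su2Rep β U V| * |combTrial ρ V| ≤ Real.exp (2 * β) ^ Fintype.card (Edge 3 L) * 1 :=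
        mul_le_mul (abs_transferKernel_le_lat hβ (U, V)) (abs_combTrial_le ρ V) (abs_nonneg _) (by positivity)
    _ = Real.exp (2 * β) ^ Fintype.card (Edge 3 L) := mul_one _

/-- `0 ≤ Φ_ρ`. [folklore] -/
theorem combPotential_nonneg (β ρ : ℝ) (U : GaugeConfig 3 L SU2) : 0 ≤ combPotential β ρ U :=
  integral_nonneg fun V => mul_nonneg (transferKernel_pos _ _ _ _).le (combTrial_nonneg ρ V)

/-- `|Φ_ρ| ≤ e^{2β|E|}` (`β ≥ 0`). [folklore] -/
theorem abs_combPotential_le {β : ℝ} (hβ : 0 ≤ β) (ρ : ℝ) (U : GaugeConfig 3 L SU2) :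
    |combPotential β ρ U| ≤ Real.exp (2 * β) ^ Fintype.card (Edge 3 L) := by
  rw [abs_of_nonneg (combPotential_nonneg β ρ U)]
  unfold combPotential
  calc ∫ V, transferKernel su2Rep β U V * combTrial ρ V ∂configMeasure SU2 L
      ≤ ∫ _V, Real.exp (2 * β) ^ Fintype.card (Edge 3 L) ∂configMeasure SU2 L :=
        integral_mono (integrable_of_bounded_lat (measurable_combPotential_integrand_left β ρ U) (abs_combPotential_integrand_le hβ ρ U))
          (integrable_const _) fun V => (le_abs_self _).trans (abs_combPotential_integrand_le hβ ρ U V)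
    _ = Real.exp (2 * β) ^ Fintype.card (Edge 3 L) := by rw [integral_const, probReal_univ, one_smul]

/-- ★ **`Φ_ρ` is gauge invariant** (`K_β(U^g,V^g) = K_β(U,V)`, `combTrial ρ (V^g) = combTrial ρ V`, the a-priori measure is gauge invariant).
[cite: SeilerLNP1982, §3] -/
theorem combPotential_gaugeTransform (β ρ : ℝ) (g : Site 3 L → SU2) (U : GaugeConfig 3 L SU2) :
    combPotential β ρ (gaugeTransform g U) = combPotential β ρ U := by
  unfold combPotential
  rw [← integral_comp_eq_of_measurePreserving (measurePreserving_gaugeTransform_configMeasure g)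
    (measurable_combPotential_integrand_left β ρ (gaugeTransform g U))]
  refine integral_congr_ae (ae_of_all _ fun V => ?_)
  simp only [transferKernel_gaugeTransform, combTrial_gaugeTransform]

/-- Hence `Φ_ρ(treeFix U) = Φ_ρ(U)`. [folklore] -/
theorem combPotential_treeFix (β ρ : ℝ) (U : GaugeConfig 3 L SU2) : combPotential β ρ (treeFix U) = combPotential β ρ U :=
  combPotential_gaugeTransform β ρ (treeGauge U) U

/-- `⟨ψ₀, K_β ψ₀⟩ = ∫ ψ₀ Φ_ρ` for `ψ₀ = combTrial ρ`. [folklore] -/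
theorem qform_combTrial_eq (β ρ : ℝ) :
    qform su2Rep β (combTrial (L := L) ρ) (combTrial ρ) = ∫ U, combTrial ρ U * combPotential β ρ U ∂configMeasure SU2 L := by
  unfold qform combPotential
  refine integral_congr_ae (ae_of_all _ fun U => ?_)
  simp only
  rw [← integral_const_mul]
  refine integral_congr_ae (ae_of_all _ fun V => ?_)
  simp only
  ring

/-! ## §3 The potential at a near-identity comb-gauge configuration -/

/-- ★★ **Lower bound of the potential**: for `β ≥ 0`, `ρ ≥ 0` and a comb-gauge configuration `W` (tree links `= 1`) all of whose links are within
`ρ/2` of `1`:  `e^{−β·8ρ²|P|} · m_β(ρ/(14L))^{|E|} ≤ Φ_ρ(W)`. [cite: Luscher1983, §2] -/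
theorem combPotential_ge {β ρ : ℝ} (hβ : 0 ≤ β) (hρ : 0 ≤ ρ) {W : GaugeConfig 3 L SU2} (hWt : ∀ e : Edge 3 L, treeEdge e = true → W e = 1)
    (hW : ∀ e : Edge 3 L, frobNorm ((W e : Matrix (Fin 2) (Fin 2) ℂ) - 1) ≤ ρ / 2) :
    Real.exp (-(β * (8 * ρ ^ 2 * Fintype.card (Plaquette 3 L)))) * windowMass β (ρ / (14 * L)) ^ Fintype.card (Edge 3 L) ≤
      combPotential β ρ W := by
  haveI : SecondCountableTopology SU2 := secondCountableTopology_su2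
  have hL1 : (1 : ℝ) ≤ L := by exact_mod_cast Nat.one_le_iff_ne_zero.mpr (NeZero.ne L)
  set r : ℝ := ρ / (14 * L) with hr
  have hr0 : 0 ≤ r := by positivity
  have hr14 : r ≤ ρ / 14 := div_le_div_of_nonneg_left hρ (by norm_num) (by nlinarith)
  have h6L : 6 * (L : ℝ) * r = 3 * ρ / 7 := by rw [hr]; field_simp; ring
  set s0 : ℝ := 8 * ρ ^ 2 * Fintype.card (Plaquette 3 L) with hs0
  have hP0 : (0 : ℝ) ≤ Fintype.card (Plaquette 3 L) := Nat.cast_nonneg _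
  set B : Set SU2 := {w : SU2 | frobNorm ((w : Matrix (Fin 2) (Fin 2) ℂ) - 1) ≤ r} with hB
  set g : SU2 → ℝ := B.indicator (linkW β) with hg
  have hgm : Measurable g := measurable_windowIntegrand β r
  have hg0 : ∀ w, 0 ≤ g w := windowIntegrand_nonneg β r
  have hgle : ∀ w, g w ≤ Real.exp (2 * β) := fun w => (le_abs_self _).trans (abs_windowIntegrand_le hβ r w)
  set f : GaugeConfig 3 L SU2 → ℝ := fun V => Real.exp (-(β * s0)) * ∏ e : Edge 3 L, g (W e * (V e)⁻¹) with hf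
  -- Step 1: the lower integrand is below `K(W,·) ψ₀`
  have hpt : ∀ V : GaugeConfig 3 L SU2, f V ≤ transferKernel su2Rep β W V * combTrial ρ V := by
    intro V
    by_cases hV : ∀ e : Edge 3 L, frobNorm (((W e * (V e)⁻¹ : SU2) : Matrix (Fin 2) (Fin 2) ℂ) - 1) ≤ r
    · have hprod : ∏ e : Edge 3 L, g (W e * (V e)⁻¹) = latE L β W V := by
        unfold latE
        exact Finset.prod_congr rfl fun e _ => by rw [hg, Set.indicator_of_mem (show W e * (V e)⁻¹ ∈ B from hV e)]
      have hVW : ∀ e : Edge 3 L, frobNorm ((V e : Matrix (Fin 2) (Fin 2) ℂ) - (W e : Matrix (Fin 2) (Fin 2) ℂ)) ≤ r := fun e => by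
        rw [← frobNorm_neg, neg_sub, frobNorm_sub_eq_mul_inv]; exact hV e
      have hVt : ∀ e : Edge 3 L, treeEdge e = true → frobNorm ((V e : Matrix (Fin 2) (Fin 2) ℂ) - 1) ≤ r := fun e he => by
        have h := hVW e
        rwa [hWt e he, OneMemClass.coe_one] at h
      have hVall : ∀ e : Edge 3 L, frobNorm ((V e : Matrix (Fin 2) (Fin 2) ℂ) - 1) ≤ ρ / 2 + r := fun e => by
        have e1 : (V e : Matrix (Fin 2) (Fin 2) ℂ) - 1 = ((V e : Matrix (Fin 2) (Fin 2) ℂ) - (W e : Matrix (Fin 2) (Fin 2) ℂ)) +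
            ((W e : Matrix (Fin 2) (Fin 2) ℂ) - 1) := by abel
        rw [e1, frobNorm_eq_norm]
        refine (norm_add_le _ _).trans ?_
        rw [← frobNorm_eq_norm, ← frobNorm_eq_norm]
        linarith [hVW e, hW e]
      have hfix : treeFix V ∈ offBox ρ := by
        refine (treeFix_mem_offBox_iff hρ V).mpr fun e => ?_
        have h := frobNorm_treeFix_sub_one_le V hr0 hVt hVall e
        linarith
      have hSW : wilsonAction su2Rep W ≤ s0 := by
        refine (wilsonAction_le_of_near_one W hW).trans ?_
        rw [hs0]
        have : (ρ / 2) ^ 2 ≤ ρ ^ 2 := by nlinarith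
        nlinarith
      have hSV : wilsonAction su2Rep V ≤ s0 := by
        refine (wilsonAction_le_of_near_one V hVall).trans ?_
        rw [hs0]
        have : (ρ / 2 + r) ^ 2 ≤ ρ ^ 2 := pow_le_pow_left₀ (by positivity) (by linarith) 2
        nlinarith
      rw [combTrial_of_mem hfix, mul_one, hf]
      dsimp only
      rw [hprod]
      exact exp_mul_latE_le_transferKernel hβ hSW hSV
    · push Not at hV
      obtain ⟨e0, he0⟩ := hV
      have hzero : ∏ e : Edge 3 L, g (W e * (V e)⁻¹) = 0 :=
        Finset.prod_eq_zero (Finset.mem_univ e0) (by rw [hg, Set.indicator_of_notMem (show W e0 * (V e0)⁻¹ ∉ B from fun h => (not_le.mpr he0) h)])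
      rw [hf]
      dsimp only
      rw [hzero, mul_zero]
      exact mul_nonneg (transferKernel_pos _ _ _ _).le (combTrial_nonneg ρ V)
  -- Step 2: integrate
  have hPm : Measurable fun V : GaugeConfig 3 L SU2 => ∏ e : Edge 3 L, g (W e * (V e)⁻¹) :=
    Finset.measurable_prod _ fun e _ => hgm.comp ((continuous_const.mul (continuous_apply e).inv).measurable)
  have hPb : ∀ V : GaugeConfig 3 L SU2, |∏ e : Edge 3 L, g (W e * (V e)⁻¹)| ≤ Real.exp (2 * β) ^ Fintype.card (Edge 3 L) := fun V => by
    rw [abs_of_nonneg (Finset.prod_nonneg fun e _ => hg0 _), ← Finset.card_univ, ← Finset.prod_const]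
    exact Finset.prod_le_prod (fun e _ => hg0 _) fun e _ => hgle _
  have hfint : Integrable f (configMeasure SU2 L) := (integrable_of_bounded_lat hPm hPb).const_mul _
  have hupint : Integrable (fun V => transferKernel su2Rep β W V * combTrial ρ V) (configMeasure SU2 L) :=
    integrable_of_bounded_lat (measurable_combPotential_integrand_left β ρ W) (abs_combPotential_integrand_le hβ ρ W)
  have hmono : ∫ V, f V ∂configMeasure SU2 L ≤ combPotential β ρ W := integral_mono hfint hupint hpt
  -- Step 3: evaluate the lower integral link by link
  have hprodint : ∫ V, ∏ e : Edge 3 L, g (W e * (V e)⁻¹) ∂configMeasure SU2 L = windowMass β r ^ Fintype.card (Edge 3 L) := by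
    rw [show (∫ V, ∏ e : Edge 3 L, g (W e * (V e)⁻¹) ∂configMeasure SU2 L) = ∏ e : Edge 3 L, ∫ v, g (W e * v⁻¹) ∂haarProbability SU2 from
      integral_fintype_prod_eq_prod (fun e v => g (W e * v⁻¹))]
    rw [Finset.prod_congr rfl fun e _ => integral_comp_mul_inv_left g (W e), Finset.prod_const, Finset.card_univ]
    rfl
  calc Real.exp (-(β * (8 * ρ ^ 2 * Fintype.card (Plaquette 3 L)))) * windowMass β (ρ / (14 * L)) ^ Fintype.card (Edge 3 L)
      = ∫ V, f V ∂configMeasure SU2 L := by rw [hf, integral_const_mul, hprodint]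
    _ ≤ combPotential β ρ W := hmono

/-! ## §4 The transfer form of the trial function -/

/-- ★ **`⟨ψ₀, K_β ψ₀⟩ ≥ e^{−8βρ²|P|} · m_β(ρ/(14L))^{|E|} · ballVol(ρ/2)^{offCount L}`** for `ψ₀ = combTrial ρ` (`β, ρ ≥ 0`): on the support of
`combTrial (ρ/2)` one has `ψ₀ = 1` and `Φ_ρ = Φ_ρ ∘ treeFix ≥` the bound of §3. [folklore] -/
theorem qform_combTrial_ge {β ρ : ℝ} (hβ : 0 ≤ β) (hρ : 0 ≤ ρ) :
    Real.exp (-(β * (8 * ρ ^ 2 * Fintype.card (Plaquette 3 L)))) * windowMass β (ρ / (14 * L)) ^ Fintype.card (Edge 3 L) *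
        ballVol (ρ / 2) ^ offCount L ≤ qform su2Rep β (combTrial (L := L) ρ) (combTrial ρ) := by
  set c : ℝ := Real.exp (-(β * (8 * ρ ^ 2 * Fintype.card (Plaquette 3 L)))) * windowMass β (ρ / (14 * L)) ^ Fintype.card (Edge 3 L) with hc
  rw [qform_combTrial_eq]
  have hpt : ∀ U : GaugeConfig 3 L SU2, c * combTrial (ρ / 2) U ≤ combTrial ρ U * combPotential β ρ U := by
    intro U
    by_cases hU : treeFix U ∈ offBox (ρ / 2)
    · have hU' : treeFix U ∈ offBox ρ := offBox_mono (by linarith) hU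
      rw [combTrial_of_mem hU, combTrial_of_mem hU', mul_one, one_mul, ← combPotential_treeFix]
      exact combPotential_ge hβ hρ (fun e he => treeFix_eq_one_of_treeEdge U he) ((treeFix_mem_offBox_iff (by positivity) U).mp hU)
    · rw [combTrial_of_not_mem hU, mul_zero]
      exact mul_nonneg (combTrial_nonneg ρ U) (combPotential_nonneg β ρ U)
  have hlow : ∫ U, c * combTrial (ρ / 2) U ∂configMeasure SU2 L = c * ballVol (ρ / 2) ^ offCount L := by
    rw [integral_const_mul, integral_combTrial]
  have hint1 : Integrable (fun U => c * combTrial (ρ / 2) U) (configMeasure SU2 L) :=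
    (integrable_of_bounded_lat (measurable_combTrial _) (abs_combTrial_le _)).const_mul c
  have hint2 : Integrable (fun U => combTrial ρ U * combPotential β ρ U) (configMeasure SU2 L) :=
    integrable_of_bounded_lat ((measurable_combTrial ρ).mul (measurable_combPotential β ρ))
      (C := 1 * Real.exp (2 * β) ^ Fintype.card (Edge 3 L)) fun U => by
      rw [abs_mul]; exact mul_le_mul (abs_combTrial_le ρ U) (abs_combPotential_le hβ ρ U) (abs_nonneg _) zero_le_one
  rw [← hlow]
  exact integral_mono hint1 hint2 hpt

/-! ## §5 The β-uniform floor -/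

variable (L) in
/-- **The β-free floor constant** `c_L = e^{−8|P|} · winConst(1/(14L))^{|E|} / (8 · (5⁸)^{offCount L})`. [folklore] -/
def uniformFloorConst : ℝ :=
  Real.exp (-(8 * (Fintype.card (Plaquette 3 L) : ℝ))) * winConst (1 / (14 * L)) ^ Fintype.card (Edge 3 L) /
    (8 * ((5 : ℝ) ^ 8) ^ offCount L)

/-- `0 < c_L`. [folklore] -/
theorem uniformFloorConst_pos : 0 < uniformFloorConst L := by
  unfold uniformFloorConst
  have hL : (0 : ℝ) < L := by exact_mod_cast Nat.pos_of_ne_zero (NeZero.ne L)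
  have hw : 0 < winConst (1 / (14 * (L : ℝ))) := winConst_pos (by positivity)
  positivity

/-- ★★★ **β-UNIFORM FLOOR**: `c_L · c_β^{|E|} ≤ λ₀(β, L)` for every `β ≥ 1`, with `c_L = uniformFloorConst L > 0` independent of `β` — the top
zero-flux transfer value of `SU(2)` on `(ℤ/L)³` is within a β-INDEPENDENT factor of the free row sum `latCE L β = c_β^{3L³}`.  Trial function: the
twist symmetrisation of the comb-gauge box indicator at radius `1/√β`. [cite: Luscher1983, §2] -/
theorem levelValue_zero_ge_uniform {β : ℝ} (hβ : 1 ≤ β) : uniformFloorConst L * latCE L β ≤ levelValue su2Rep L β 0 := by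
  have hβ0 : 0 < β := by linarith
  have hL : (0 : ℝ) < L := by exact_mod_cast Nat.pos_of_ne_zero (NeZero.ne L)
  have hsβ : 0 < Real.sqrt β := Real.sqrt_pos.2 hβ0
  set ρ : ℝ := 1 / Real.sqrt β with hρ
  have hρ0 : 0 < ρ := by positivity
  -- the trial function and its twist symmetrisation
  have hφm := measurable_combTrial (L := L) ρ
  have hφb : ∀ U : GaugeConfig 3 L SU2, |combTrial ρ U| ≤ 1 := abs_combTrial_le ρ
  have hψ : IsPhys (twistSum (combTrial (L := L) ρ)) := isPhys_twistSum hφm ⟨1, hφb⟩ (combTrial_gaugeTransform ρ)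
  -- norms
  have hn : l2 (combTrial (L := L) ρ) (combTrial ρ) = ballVol ρ ^ offCount L := l2_combTrial ρ
  have hb : 0 < ballVol (ρ / 2) := ballVol_pos (by positivity)
  have hbN : 0 < ballVol (ρ / 2) ^ offCount L := pow_pos hb _
  have hl2_le : l2 (twistSum (combTrial (L := L) ρ)) (twistSum (combTrial ρ)) ≤ 64 * l2 (combTrial (L := L) ρ) (combTrial ρ) :=
    l2_twistSum_le hφm hφb
  have hl2_ge : 8 * l2 (combTrial (L := L) ρ) (combTrial ρ) ≤ l2 (twistSum (combTrial (L := L) ρ)) (twistSum (combTrial ρ)) :=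
    l2_twistSum_ge hφm hφb (combTrial_nonneg ρ)
  have hl2_pos : 0 < l2 (twistSum (combTrial (L := L) ρ)) (twistSum (combTrial ρ)) := by
    refine lt_of_lt_of_le ?_ hl2_ge
    rw [hn]; exact mul_pos (by norm_num) (pow_pos (ballVol_pos hρ0) _)
  have hball : ballVol ρ ^ offCount L ≤ ((5 : ℝ) ^ 8) ^ offCount L * ballVol (ρ / 2) ^ offCount L := ballVol_pow_le_half hρ0.le _
  -- forms
  have hq8 : 8 * qform su2Rep β (combTrial (L := L) ρ) (combTrial ρ) ≤ qform su2Rep β (twistSum (combTrial (L := L) ρ)) (twistSum (combTrial ρ)) :=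
    qform_twistSum_ge hβ0.le hφm hφb (combTrial_nonneg ρ)
  have hq0 := qform_combTrial_ge (L := L) hβ0.le hρ0.le
  have hβρ : β * (8 * ρ ^ 2 * Fintype.card (Plaquette 3 L)) = 8 * (Fintype.card (Plaquette 3 L) : ℝ) := by
    rw [hρ, div_pow, one_pow, Real.sq_sqrt hβ0.le]; field_simp
  rw [hβρ] at hq0
  -- the window mass in units of the normaliser
  have hwin : winConst (1 / (14 * L)) * linkC β ≤ windowMass β (ρ / (14 * L)) := by
    have e : ρ / (14 * L) = 1 / (14 * L) / Real.sqrt β := by rw [hρ]; field_simp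
    rw [e]
    refine windowMass_ge_linkC hβ (by positivity) ?_
    have hL1 : (1 : ℝ) ≤ L := by exact_mod_cast Nat.one_le_iff_ne_zero.mpr (NeZero.ne L)
    rw [div_le_one (by positivity)]; linarith
  have hwin0 : 0 ≤ winConst (1 / (14 * L)) * linkC β := mul_nonneg (winConst_nonneg _) (linkC_pos hβ0.le).le
  have hwinpow : (winConst (1 / (14 * L)) * linkC β) ^ Fintype.card (Edge 3 L) ≤ windowMass β (ρ / (14 * L)) ^ Fintype.card (Edge 3 L) :=
    pow_le_pow_left₀ hwin0 hwin _
  -- min–max door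
  have hdoor := qform_le_levelValue_zero_mul su2Rep continuous_su2Rep β hψ hl2_pos
  have hlam0 : 0 ≤ levelValue su2Rep L β 0 := by rw [levelValue_zero]; exact topValue_nonneg su2Rep L β
  -- the chain
  set E8 : ℝ := Real.exp (-(8 * (Fintype.card (Plaquette 3 L) : ℝ))) with hE8
  set F : ℝ := ((5 : ℝ) ^ 8) ^ offCount L with hF
  have hF0 : 0 < F := by positivity
  have key : 8 * E8 * (winConst (1 / (14 * L)) * linkC β) ^ Fintype.card (Edge 3 L) * ballVol (ρ / 2) ^ offCount L ≤
      levelValue su2Rep L β 0 * (64 * F) * ballVol (ρ / 2) ^ offCount L := by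
    calc 8 * E8 * (winConst (1 / (14 * L)) * linkC β) ^ Fintype.card (Edge 3 L) * ballVol (ρ / 2) ^ offCount L
        ≤ 8 * (E8 * windowMass β (ρ / (14 * L)) ^ Fintype.card (Edge 3 L) * ballVol (ρ / 2) ^ offCount L) := by
          have := mul_le_mul_of_nonneg_left hwinpow (Real.exp_pos (-(8 * (Fintype.card (Plaquette 3 L) : ℝ)))).le
          nlinarith [hbN.le]
      _ ≤ 8 * qform su2Rep β (combTrial (L := L) ρ) (combTrial ρ) := by linarith [hq0]
      _ ≤ qform su2Rep β (twistSum (combTrial (L := L) ρ)) (twistSum (combTrial ρ)) := hq8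
      _ ≤ levelValue su2Rep L β 0 * l2 (twistSum (combTrial (L := L) ρ)) (twistSum (combTrial ρ)) := hdoor
      _ ≤ levelValue su2Rep L β 0 * (64 * (ballVol ρ ^ offCount L)) := by
          rw [← hn]; exact mul_le_mul_of_nonneg_left hl2_le hlam0
      _ ≤ levelValue su2Rep L β 0 * (64 * F) * ballVol (ρ / 2) ^ offCount L := by
          have := mul_le_mul_of_nonneg_left hball hlam0
          nlinarith
  have key' : 8 * E8 * (winConst (1 / (14 * L)) * linkC β) ^ Fintype.card (Edge 3 L) ≤ levelValue su2Rep L β 0 * (64 * F) :=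
    le_of_mul_le_mul_right key hbN
  calc uniformFloorConst L * latCE L β
      = 8 * E8 * (winConst (1 / (14 * L)) * linkC β) ^ Fintype.card (Edge 3 L) / (64 * F) := by
        rw [uniformFloorConst, latCE, ← hE8, ← hF, mul_pow]
        field_simp
        ring
    _ ≤ levelValue su2Rep L β 0 * (64 * F) / (64 * F) := div_le_div_of_nonneg_right key' (by positivity)
    _ = levelValue su2Rep L β 0 := mul_div_cancel_right₀ _ (by positivity)

/-- ★★★ The floor in existential form: `∃ c > 0, ∀ β ≥ 1, c · latCE L β ≤ λ₀(β, L)`. [cite: Luscher1983, §2] -/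
theorem exists_levelValue_zero_ge_uniform : ∃ c : ℝ, 0 < c ∧ ∀ β : ℝ, 1 ≤ β → c * latCE L β ≤ levelValue su2Rep L β 0 :=
  ⟨uniformFloorConst L, uniformFloorConst_pos, fun _ hβ => levelValue_zero_ge_uniform hβ⟩

end Summit.QuantumFields.YangMills.Theorems.FemtoTransferGap

end
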